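import Summits.ValiantsHypothesis.ValiantsHypothesis.Theorems.BarrierLeverAnchoredDoorHitsLowerPairsStarVertexRich

/-!
# Route BarrierLever — support item `AnchoredDoorHitsLowerPairs` (stmt-ValiantsHypothesis-22510), line `anchored_peeling`:
# THE TWO-CENTRE DEGENERATION and the node «STAR-LOWER = vertex-rich THEOREM + two-centre conjecture on face-rich pairs»

Helper / node file (`--supports stmt-ValiantsHypothesis-22510`; val-np-p1 g34). Door slot of record `Stmt.conjStarLower`
(…StarDoor). Closes NO item; nothing here bears on crux 14610 or on `VP ≠ VNP`, which is NOT proved; `Stmt.conjStarLower` is NOT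
proved here.

THE DEVICE (companion of …StarOneCentre). On the uniform scaling family `g = ḡ·X`, `d = d̄·X` use the potentials
`|A| − [|A| ≥ 2]` (rows) and `|S| − [|S| ≥ 2]` (columns): a nonzero summand of `starEntry` on a row face and a column face of
size `≥ 2` has at least TWO centres (`scDeg_le_tcPot`), so the degree is at most the potential and the top coefficient is the
TWO-CENTRE MATRIX `twoTop ḡ d̄ A S` (`coeff_starEntry_tc`): `[∅,∅] = 1`, vertex × vertex `= 0`, vertex `b` × face `S`: `∏_{e∈S} d̄ b e`,
face `A` × vertex `e`: `∏_{b∈A} ḡ b e`, face × face: the sum of the two-centre star forests (double stars `ḡ_e^{A∖b} d̄_b^{S∖e}`, plus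
the two-row-centre forests when `|A| = 2` and the two-column-centre forests when `|S| = 2`). PRINCIPLE `starDet_ne_zero_of_twoTop`.

THE NODE. `Stmt.conjStarTwoCentre`: on every injective lower pair with `r > n₁ + n₂ + 1` (FACE-RICH: more faces of size `≥ 2` on
each side than vertices on the other) the two-centre matrix is nonsingular for some complex `ḡ, d̄`. With the THEOREM
`starDet_ne_zero_of_vertexRich` (…StarVertexRich: every pair with `r ≤ n₁ + n₂ + 1` is star-good) it gives `Stmt.conjStarLower`
(`conjStarLower_of_twoCentre`) and the item (`anchoredDoorHitsLowerPairs_of_twoCentre`). Also the plain restriction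
`Stmt.conjStarLowerFaceRich` (STAR-LOWER on face-rich pairs) with `conjStarLower_of_faceRich`. CENSUS (val-np-p1 g34, lab/t2census.py):
the two-centre matrix is nonsingular on EVERY balanced or face-rich ordered lower pair on `≤ 5 + 5` vertices (3 416 + 120 at `5+5`,
86 + 14 at `4+5`, …; zero failures) and on the named pairs `(K₅, K_{1,6} ⊔ 2K₂)`, `(K₆, K_{2,6} ⊔ pt)`, `(2^{[4]}, B(5,2))`, cubes; it is
SINGULAR on vertex-rich pairs (a zero block), where the one-centre matrix takes over — a clean dichotomy. WHY IT MIGHT FAIL: a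
face-rich lower pair whose two-centre matrix is identically singular; by the Schur complement this is a degenerate TRACE PAIRING
`(f, φ) ↦ Σ_{b,e} ∂_b f(ḡ_e) ∂_e φ(d̄_b) + (edge terms)` between the polynomials `f ∈ span{x^A : A ∈ I, |A| ≥ 2}` vanishing at the
column points `ḡ_e` and the polynomials `φ ∈ span{y^S}` vanishing at the row points `d̄_b` (both spaces of dimension `r − 1 − n₁ − n₂`).
-/

set_option linter.dupNamespace false

namespace Summit.ValiantsHypothesis.ValiantsHypothesis.Theorems.BarrierLever.AnchoredPeeling

open Finset Polynomial

noncomputable section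

namespace StarDoor

variable {K : Type*} [CommRing K] {h : ℕ}

/-! ## 1. The two-centre potential and matrix -/

section Defs

variable (gb db : Fin h → Fin h → K)

/-- `1` on faces of size `≥ 2`, `0` on the empty face and on vertices. -/
def bigInd (A : Finset (Fin h)) : ℕ := if 2 ≤ A.card then 1 else 0

/-- The TWO-CENTRE POTENTIAL `(|A| − [|A| ≥ 2]) + (|S| − [|S| ≥ 2])`. -/
def tcPot (A S : Finset (Fin h)) : ℕ := (A.card - bigInd A) + (S.card - bigInd S)

/-- **The two-centre matrix entry**: the `X^{tcPot A S}`-coefficient of `starEntry` on the uniform scaling family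
(`coeff_starEntry_tc`), defined as the sum of the coefficients of the summands of top degree. -/
def twoTop (A S : Finset (Fin h)) : K :=
  ∑ A' ∈ A.powerset, ∑ S' ∈ S.powerset, if scDeg A S A' S' = tcPot A S then scCoef gb db A S A' S' else 0

/-- Ring homomorphisms pass through `twoTop`. -/
theorem map_twoTop {L : Type*} [CommRing L] (f : K →+* L) (A S : Finset (Fin h)) :
    f (twoTop gb db A S) = twoTop (fun b e => f (gb b e)) (fun b e => f (db b e)) A S := by
  unfold twoTop scCoef
  simp only [map_sum, apply_ite f, map_zero, map_mul, map_prod]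

/-- `bigInd ≤ 1`. -/
theorem bigInd_le_one (A : Finset (Fin h)) : bigInd A ≤ 1 := by
  unfold bigInd; split_ifs <;> omega

/-- `bigInd A ≤ |A|`. -/
theorem bigInd_le_card (A : Finset (Fin h)) : bigInd A ≤ A.card := by
  unfold bigInd; split_ifs <;> omega

/-- **Degree bound for a nonzero summand:** a nonzero summand on two faces of size `≥ 2` has at least two centres, on one such
face at least one; so `#leaves ≤ tcPot`. -/
theorem scDeg_le_tcPot {A S A' S' : Finset (Fin h)} (hA' : A' ⊆ A) (hS' : S' ⊆ S)
    (hc : scCoef gb db A S A' S' ≠ 0) : scDeg A S A' S' ≤ tcPot A S := by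
  unfold scDeg tcPot
  rw [Finset.card_sdiff_of_subset hA', Finset.card_sdiff_of_subset hS']
  have hA'le : A'.card ≤ A.card := Finset.card_le_card hA'
  have hS'le : S'.card ≤ S.card := Finset.card_le_card hS'
  -- a row leaf needs a column centre, a column leaf needs a row centre
  have hrow : A'.card < A.card → 1 ≤ S'.card := fun hlt => by
    by_contra h0
    have hS'0 : S' = ∅ := Finset.card_eq_zero.mp (by omega)
    apply hc
    refine scCoef_eq_zero_of_row gb db ?_ hS'0
    rw [← Finset.card_pos, Finset.card_sdiff_of_subset hA']; omega
  have hcol : S'.card < S.card → 1 ≤ A'.card := fun hlt => by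
    by_contra h0
    have hA'0 : A' = ∅ := Finset.card_eq_zero.mp (by omega)
    apply hc
    refine scCoef_eq_zero_of_col gb db ?_ hA'0
    rw [← Finset.card_pos, Finset.card_sdiff_of_subset hS']; omega
  have f1 : 2 ≤ A.card → 1 ≤ A'.card + S'.card := fun h2 => by
    rcases Nat.lt_or_ge A'.card A.card with h | h
    · have := hrow h; omega
    · omega
  have f2 : 2 ≤ S.card → 1 ≤ A'.card + S'.card := fun h2 => by
    rcases Nat.lt_or_ge S'.card S.card with h | h
    · have := hcol h; omega
    · omega
  have f3 : 2 ≤ A.card → 2 ≤ S.card → 2 ≤ A'.card + S'.card := fun hA2 hS2 => by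
    by_contra hlt
    rcases Nat.lt_or_ge A'.card A.card with h | h
    · have h1 := hrow h
      have h' : S'.card < S.card := by omega
      have h2 := hcol h'
      omega
    · omega
  by_cases hA2 : 2 ≤ A.card
  · by_cases hS2 : 2 ≤ S.card
    · rw [bigInd, bigInd, if_pos hA2, if_pos hS2]; have := f3 hA2 hS2; omega
    · rw [bigInd, bigInd, if_pos hA2, if_neg hS2]; have := f1 hA2; omega
  · by_cases hS2 : 2 ≤ S.card
    · rw [bigInd, bigInd, if_neg hA2, if_pos hS2]; have := f2 hS2; omega
    · rw [bigInd, bigInd, if_neg hA2, if_neg hS2]; omega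

end Defs

/-! ## 2. Degree bound and top coefficient on the uniform scaling family -/

section Family

variable (gb db : Fin h → Fin h → ℂ)

/-- **Degree bound:** `starEntry` on the family has degree at most the two-centre potential. -/
theorem natDegree_starEntry_tc_le (A S : Finset (Fin h)) :
    (starEntry (gSc gb) (dSc db) A S).natDegree ≤ tcPot A S := by
  classical
  rw [starEntry_sc_eq]
  refine natDegree_sum_le_of_forall_le _ _ fun A' hA' => natDegree_sum_le_of_forall_le _ _ fun S' hS' => ?_
  by_cases hc : scCoef gb db A S A' S' = 0
  · rw [hc, map_zero, zero_mul, natDegree_zero]; exact Nat.zero_le _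
  · exact (natDegree_C_mul_X_pow_le _ _).trans
      (scDeg_le_tcPot gb db (Finset.mem_powerset.mp hA') (Finset.mem_powerset.mp hS') hc)

/-- **Top coefficient:** the `X^{tcPot A S}`-coefficient of `starEntry` on the family is `twoTop ḡ d̄ A S`. -/
theorem coeff_starEntry_tc (A S : Finset (Fin h)) :
    (starEntry (gSc gb) (dSc db) A S).coeff (tcPot A S) = twoTop gb db A S := by
  classical
  rw [starEntry_sc_eq, finsetSum_coeff]
  unfold twoTop
  refine Finset.sum_congr rfl fun A' _ => ?_
  rw [finsetSum_coeff]
  refine Finset.sum_congr rfl fun S' _ => ?_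
  rw [coeff_C_mul_X_pow]
  by_cases hdeg : scDeg A S A' S' = tcPot A S
  · rw [if_pos hdeg.symm, if_pos hdeg]
  · rw [if_neg (fun h' => hdeg h'.symm), if_neg hdeg]

end Family

/-! ## 3. The two-centre principle -/

section Principle

variable {r : ℕ} (u w : Fin r → Finset (Fin h)) (gb db : Fin h → Fin h → ℂ)

/-- **THE TWO-CENTRE PRINCIPLE.** For ANY row and column families `u w` and ANY complex `ḡ, d̄`: if the two-centre matrix
`(twoTop ḡ d̄ (u i) (w j))_{i j}` is nonsingular, then some complex weights make the star-forest block nonsingular. -/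
theorem starDet_ne_zero_of_twoTop
    (hN : (Matrix.of fun i j : Fin r => twoTop gb db (u i) (w j)).det ≠ 0) :
    ∃ g d : Fin h → Fin h → ℂ, (Matrix.of fun i j : Fin r => starEntry g d (u i) (w j)).det ≠ 0 := by
  classical
  let a : Fin r → ℕ := fun i => (u i).card - bigInd (u i)
  let c : Fin r → ℕ := fun j => (w j).card - bigInd (w j)
  let Ka : ℕ := ∑ i, a i
  let Kc : ℕ := ∑ j, c j
  have ha : ∀ i, a i ≤ Ka := fun i => Finset.single_le_sum (f := a) (fun i _ => Nat.zero_le _) (Finset.mem_univ i)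
  have hc : ∀ j, c j ≤ Kc := fun j => Finset.single_le_sum (f := c) (fun j _ => Nat.zero_le _) (Finset.mem_univ j)
  have hpot : ∀ i j, tcPot (u i) (w j) = a i + c j := fun i j => rfl
  let MP : Matrix (Fin r) (Fin r) ℂ[X] := Matrix.of fun i j => starEntry (gSc gb) (dSc db) (u i) (w j)
  let MS : Matrix (Fin r) (Fin r) ℂ[X] := Matrix.of fun i j => X ^ (Ka - a i) * MP i j * X ^ (Kc - c j)
  have hdeg : ∀ i j, (MS i j).natDegree ≤ Ka + Kc := by
    intro i j
    simp only [MS, MP, Matrix.of_apply]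
    have h1 : (starEntry (gSc gb) (dSc db) (u i) (w j)).natDegree ≤ a i + c j := by
      rw [← hpot]; exact natDegree_starEntry_tc_le gb db (u i) (w j)
    calc (X ^ (Ka - a i) * starEntry (gSc gb) (dSc db) (u i) (w j) * X ^ (Kc - c j)).natDegree
        ≤ (X ^ (Ka - a i) * starEntry (gSc gb) (dSc db) (u i) (w j)).natDegree + (X ^ (Kc - c j) : ℂ[X]).natDegree :=
          natDegree_mul_le
      _ ≤ ((X ^ (Ka - a i) : ℂ[X]).natDegree + (starEntry (gSc gb) (dSc db) (u i) (w j)).natDegree)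
            + (X ^ (Kc - c j) : ℂ[X]).natDegree :=
          Nat.add_le_add_right natDegree_mul_le _
      _ ≤ ((Ka - a i) + (a i + c j)) + (Kc - c j) := by
          gcongr
          · exact natDegree_X_pow_le _
          · exact natDegree_X_pow_le _
      _ = Ka + Kc := by have := ha i; have := hc j; omega
  have hcoefMS : (MS.map fun p => p.coeff (Ka + Kc)) = Matrix.of fun i j : Fin r => twoTop gb db (u i) (w j) := by
    ext i j
    simp only [MS, MP, Matrix.map_apply, Matrix.of_apply]
    have hK : Ka + Kc = ((a i + c j) + (Ka - a i)) + (Kc - c j) := by have := ha i; have := hc j; omega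
    rw [hK, coeff_mul_X_pow, coeff_X_pow_mul, ← hpot, coeff_starEntry_tc]
  have hcoef : (MS.det).coeff (Fintype.card (Fin r) * (Ka + Kc)) = (Matrix.of fun i j : Fin r => twoTop gb db (u i) (w j)).det := by
    rw [Literature.AlgebraicGeometry.DeterminantalHypersurfaces.coeff_det_of_natDegree_le MS (Ka + Kc) hdeg, hcoefMS]
  have hMS : MS.det ≠ 0 := by
    intro h0
    apply hN
    rw [← hcoef, h0, coeff_zero]
  have hMSeq : MS = Matrix.diagonal (fun i => (X : ℂ[X]) ^ (Ka - a i)) * MP * Matrix.diagonal (fun j => (X : ℂ[X]) ^ (Kc - c j)) := by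
    ext i j
    simp only [MS, Matrix.of_apply, Matrix.mul_diagonal, Matrix.diagonal_mul]
  have hMP : MP.det ≠ 0 := by
    intro h0
    apply hMS
    rw [hMSeq, Matrix.det_mul, Matrix.det_mul, h0, mul_zero, zero_mul]
  have hex : ∃ t : ℂ, ¬ (MP.det).IsRoot t := by
    by_contra hall
    push Not at hall
    apply hMP
    apply Polynomial.eq_zero_of_infinite_isRoot
    have huniv : {x : ℂ | (MP.det).IsRoot x} = Set.univ := Set.eq_univ_of_forall fun x => hall x
    rw [huniv]
    exact Set.infinite_univ
  obtain ⟨t, ht⟩ := hex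
  refine ⟨fun b e => Polynomial.eval t (gSc gb b e), fun b e => Polynomial.eval t (dSc db b e), ?_⟩
  have hev : Polynomial.eval t MP.det =
      (Matrix.of fun i j : Fin r => starEntry (fun b e => Polynomial.eval t (gSc gb b e))
        (fun b e => Polynomial.eval t (dSc db b e)) (u i) (w j)).det := by
    rw [← Polynomial.coe_evalRingHom, RingHom.map_det, RingHom.mapMatrix_apply]
    congr 1; ext i j; simp only [MP, Matrix.map_apply, Matrix.of_apply]; rw [map_starEntry]
  rw [← hev]
  exact ht

end Principle

end StarDoor

/-! ## 4. The nodes and the arrows -/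

/-- **NODE TEXT (val-np-p1 g34): STAR-LOWER ON FACE-RICH PAIRS.** For every pair of injective enumerations `u, w` of lower
families with `#{i : |u i| = 1} + #{j : |w j| = 1} + 1 < r` (the complement of the vertex-rich class, which is a THEOREM:
`StarDoor.starDet_ne_zero_of_vertexRich`), some complex edge weights make the star-forest block nonsingular. A 1:1 weaker
replacement of `Stmt.conjStarLower` (`conjStarLower_of_faceRich`). WHY IT MIGHT FAIL: as STAR-LOWER — one face-rich lower pair all of
whose star-forest blocks are singular (none in the census of record). -/
def Stmt.conjStarLowerFaceRich : Prop :=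
  ∀ (h r : ℕ) (u w : Fin r → Finset (Fin h)), Function.Injective u → Function.Injective w →
    IsLowerSet (Set.range u) → IsLowerSet (Set.range w) →
    (univ.filter fun i => (u i).card = 1).card + (univ.filter fun j => (w j).card = 1).card + 1 < r →
    ∃ g d : Fin h → Fin h → ℂ, (Matrix.of fun i j : Fin r => StarDoor.starEntry g d (u i) (w j)).det ≠ 0

/-- **NODE TEXT (val-np-p1 g34): CONJECTURE TWO-CENTRE.** On every FACE-RICH injective lower pair (`r > n₁ + n₂ + 1`) the two-centre
matrix `(twoTop ḡ d̄ (u i) (w j))` is nonsingular for some complex `ḡ, d̄`. STRONGER than `Stmt.conjStarLowerFaceRich`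
(`conjStarLowerFaceRich_of_twoCentre`); census-clean (every balanced / face-rich lower pair on `≤ 5+5` vertices, the named pairs).
WHY IT MIGHT FAIL: a face-rich lower pair on which the trace pairing between the vanishing polynomials of the two sides is
degenerate for all points (see the file header); then STAR-LOWER might still hold by a deeper degeneration. -/
def Stmt.conjStarTwoCentre : Prop :=
  ∀ (h r : ℕ) (u w : Fin r → Finset (Fin h)), Function.Injective u → Function.Injective w →
    IsLowerSet (Set.range u) → IsLowerSet (Set.range w) →
    (univ.filter fun i => (u i).card = 1).card + (univ.filter fun j => (w j).card = 1).card + 1 < r →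
    ∃ gb db : Fin h → Fin h → ℂ, (Matrix.of fun i j : Fin r => StarDoor.twoTop gb db (u i) (w j)).det ≠ 0

/-- **ARROW:** the two-centre conjecture gives STAR-LOWER on face-rich pairs (the two-centre principle). -/
theorem conjStarLowerFaceRich_of_twoCentre (H : Stmt.conjStarTwoCentre) : Stmt.conjStarLowerFaceRich := by
  intro h r u w hu hw hlu hlw hface
  obtain ⟨gb, db, hN⟩ := H h r u w hu hw hlu hlw hface
  exact StarDoor.starDet_ne_zero_of_twoTop u w gb db hN

/-- **ARROW:** STAR-LOWER on face-rich pairs ⟹ STAR-LOWER (the vertex-rich pairs are the theorem `starDet_ne_zero_of_vertexRich`). -/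
theorem conjStarLower_of_faceRich (H : Stmt.conjStarLowerFaceRich) : Stmt.conjStarLower := by
  intro h r u w hu hw hlu hlw
  by_cases hrich : r ≤ (univ.filter fun i => (u i).card = 1).card + (univ.filter fun j => (w j).card = 1).card + 1
  · exact StarDoor.starDet_ne_zero_of_vertexRich u w hu hw hlu hlw hrich
  · exact H h r u w hu hw hlu hlw (Nat.lt_of_not_le hrich)

/-- **ARROW:** the two-centre conjecture ⟹ STAR-LOWER. -/
theorem conjStarLower_of_twoCentre (H : Stmt.conjStarTwoCentre) : Stmt.conjStarLower :=
  conjStarLower_of_faceRich (conjStarLowerFaceRich_of_twoCentre H)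

/-- **… hence the item, from STAR-LOWER on face-rich pairs.** -/
theorem anchoredDoorHitsLowerPairs_of_faceRich (H : Stmt.conjStarLowerFaceRich) :
    Summit.ValiantsHypothesis.ValiantsHypothesis.Theses.BarrierLever.AnchoredDoorHitsLowerPairs :=
  anchoredDoorHitsLowerPairs_of_conjStarLower (conjStarLower_of_faceRich H)

/-- **… hence the item, from the two-centre conjecture.** -/
theorem anchoredDoorHitsLowerPairs_of_twoCentre (H : Stmt.conjStarTwoCentre) :
    Summit.ValiantsHypothesis.ValiantsHypothesis.Theses.BarrierLever.AnchoredDoorHitsLowerPairs :=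
  anchoredDoorHitsLowerPairs_of_conjStarLower (conjStarLower_of_twoCentre H)

end

end Summit.ValiantsHypothesis.ValiantsHypothesis.Theorems.BarrierLever.AnchoredPeeling
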